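import Mathlib
import HarnessLib
import Summits.HubbardSuperconductivity.HubbardSuperconductivity.Theorems.KLProgrammeKLRegimeEnginePairTransferMemberSplit3
import Summits.HubbardSuperconductivity.HubbardSuperconductivity.Theorems.KLProgrammeKLRegimeEnginePairTransferDLineEdgeSplitCellsSharpTC

/-!
# Route `KLProgramme` — ENGINE stmt-HubbardSuperconductivity-20437 `KLRegimeEngineV17F2`, row (c) value lane «(c)-OUT»: the MEMBER signed PH rows (classes `RP`/`RQ` of the
# same-frame step (i)) with ANGULAR-CELL kernel data and under the CELL SPLIT `V_j⊗V_j = c + F₁ + Σ_w F₂ʷ` (brick (L4)-1 of cure (A″) route 3′ of located «(c)-OUT-COOPER-ANTIPODE»;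
# cell gate-hubbard-kl, seat hubbard-kl-k3c2-p2 g26, technique «thermal-bar induction n ≤ nScales β + 1 with EngineBoundsAtV4S sums»)

Twins of …PairTransferMemberSplit3 (`klms_member_*_signed_le_gen`, `member_*_signed_le_split3`): the `F₁` pin carries a GLOBAL torus-Lipschitz constant `K_g` (any size) and
ANGULAR-CELL data (arcs `[α_c, β_c]` covering `(−π,π)`, serving sets `S_c` around the frame's Fermi curve, cell constants `Lc_c`; `klms_pinned_bubble_norm_le_genTCC`), so its row
is the SHARP-TC angular-cell bound `klmsRowBoundTCC … A₁ K_g I₁ I_δ …` (`I₁ = Σ_c Lc_c(β_c − α_c)`, `I_δ = Σ_c (2Lc_c + 4K_g)(π/L)(β_c − α_c)`); the window part is a FINITE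
FAMILY `Σ_w F₂ʷ` (sup `A₂ʷ`, support `|k − cen_w|_𝕋 ≤ ρ_w`; cell flatness is booked this way), each booked by `klms_weighted_*_norm_le_of_support_soft` at the member's softness
scale `n`.  The constant part `c` keeps its landed row (`klmsRowBound (2‖c‖) 0`, resp. `(‖c‖) 0`).
* **`klms_member_direct_signed_le_genTCC`**, **`klms_member_crossed_signed_le_genTCC`**; **`member_direct_signed_le_splitCells`**, **`member_crossed_signed_le_splitCells`**.
Pure composition; the split and its data are binders; nothing asserts (X).3, (c), K3 or superconductivity.  0 kit · 0 lit.
-/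

noncomputable section

namespace Summit.HubbardSuperconductivity.HubbardSuperconductivity.Theorems.KLRegimeSplit

set_option linter.dupNamespace false -- summit = problem name (single-conjunct summit), D-0017

open Real Set Finset Complex Literature.MathematicalPhysics.QuantumLattice
open Literature.Probability.LatticeModels hiding torusSupNorm
open Literature.MathematicalPhysics.QuantumLattice.BandSectorCounting
open Summit.HubbardSuperconductivity.HubbardSuperconductivity.Theorems.KLProgrammeLegKernels
open Summit.HubbardSuperconductivity.HubbardSuperconductivity.Theorems.KLRegimeWick
open Summit.HubbardSuperconductivity.HubbardSuperconductivity.Theorems.TwoPointAssembly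
open Summit.HubbardSuperconductivity.HubbardSuperconductivity.Theorems.DispersionFlow
open Summit.HubbardSuperconductivity.HubbardSuperconductivity.Theorems.PerturbedFermiCurve
open Summit.HubbardSuperconductivity.HubbardSuperconductivity.Theorems.EngineV8

variable {L M : ℕ} [NeZero L] [NeZero M] (β μ : ℝ) (K : TrigPolyC4v)

section Model

variable {a' b' : ℝ} (B : BandBounds a' b') {R : RenConsts} {U : ℝ} {N : ℕ} {A : ℝ}

/-! ## §1 The member signed rows for a generic resolved kernel with angular-cell pin data -/

/-- **MEMBER DIRECT SIGNED ROW, GENERIC KERNEL** (`n+1 ≤ j`, window `G|p_{x−y}|_𝕋 ≤ Λₙ₊₁/8`): partner `Φ_j(t)` (line `klPhiC Λ_j Λ(t)`), resolved kernel `F` with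
momentum pin `F₀` (`A₀`/`L_A` bound the σ-summed pin along `k ↦ (k, k + (x−y))` and `k ↦ (k − (x−y), k)`, `ε` the flatness on `ω² ≤ (4Λₙ₊₁)²`) ⟹
`‖S_Φ[F]‖ ≤ (βL²)²(βL²·Row_j(A₀,L_A; G|p_{x−y}|) ×2) + ε·(512/3)(βL²)²/Λ(t)²·Σ|Φ_j(t)|‖ĝ‖`. -/
theorem klms_member_direct_signed_le_genTCC (hR : ∀ j, 0 ≤ R.Gfr j) (hK : FrameOK R U N μ K)
    (hAb : ∀ p : Momentum, ∀ j ≤ 2, ‖iteratedFDeriv ℝ j (frameShift K) p‖ ≤ A) (hA : 4 * A < B.Dtmin) (hA20 : 4 * A ≤ 1 / 20) (hμ : μ ≤ -0.15)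
    (n : ℕ) {t : ℝ} (ht : t ∈ Icc (0 : ℝ) 1) (hβ : klBetaMin ≤ β) (hn : n + 1 ≤ nScales β + 1)
    (hM : β * (4 * klScale klE0 (n + 1)) / (2 * Real.pi) + 1 ≤ M)
    (Φ : ℕ → ℝ → FreqMomentum L M → ℝ) (hΦ : Φ = fun j t k => (softSymbolCompl L M β μ K (n + 1) j) k + (hubbardCutoffWeightCT L M β μ K (klScale klE0 (n + 1)) k -
            hubbardCutoffWeightCT L M β μ K (klScale klE0 n + t * (klScale klE0 (n + 1) - klScale klE0 n)) k))
    (Wd : ℝ → FreqMomentum L M → ℝ) (hWd : Wd = fun t k => deriv (fun Λ' : ℝ => hubbardCutoffWeightCT L M β μ K Λ' k) (klScale klE0 n + t * (klScale klE0 (n + 1) - klScale klE0 n)))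
    {j : ℕ} (hj : n + 1 ≤ j) (x y : TorusSite 2 L)
    (hlo : a' < μ - 4 * klScale klE0 (n + 1) - 4 * A) (hhi : μ + 4 * klScale klE0 (n + 1) + 4 * A < b')
    (hq : (4 + 8 / 3 * R.Gfr 1 * U ^ 2) * klTorusNorm L (x - y) ≤ klScale klE0 (n + 1) / 8)
    (F : FreqMomentum L M → Fin 2 → FreqMomentum L M → ℂ) (F₀ : TorusSite 2 L → Fin 2 → TorusSite 2 L → ℂ)
    {A₀ Kg ε : ℝ} (hA0 : 0 ≤ A₀) (hKg : 0 ≤ Kg) (hε : 0 ≤ ε)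
    (hY0p : ∀ k : TorusSite 2 L, ‖∑ σ : Fin 2, F₀ k σ (k + (x - y))‖ ≤ A₀)
    (hY1p : ∀ k k' : TorusSite 2 L, ‖(∑ σ : Fin 2, F₀ k σ (k + (x - y))) - ∑ σ : Fin 2, F₀ k' σ (k' + (x - y))‖ ≤ Kg * klTorusNorm L (k - k'))
    (hY0m : ∀ k : TorusSite 2 L, ‖∑ σ : Fin 2, F₀ (k + -(x - y)) σ k‖ ≤ A₀)
    (hY1m : ∀ k k' : TorusSite 2 L, ‖(∑ σ : Fin 2, F₀ (k + -(x - y)) σ k) - ∑ σ : Fin 2, F₀ (k' + -(x - y)) σ k'‖ ≤ Kg * klTorusNorm L (k - k'))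
    {ι : Type*} [Fintype ι] {S : ι → Finset (TorusSite 2 L)} {αc βc Lc : ι → ℝ} (hαβ : ∀ c, αc c ≤ βc c) (hLc : ∀ c, 0 ≤ Lc c)
    {r : ℝ} (hr : 4 * klScale klE0 (n + 1) / (B.Dtmin - 4 * A) + Real.pi / L ≤ r)
    (hserve : ∀ c, ∀ θ ∈ Icc (αc c) (βc c), ∀ k : TorusSite 2 L,
      torusSupNorm (klpeP L k -
        (perturbedFermiRadius (fun k : Fin 2 → ℝ => frameShift K (WithLp.toLp 2 k)) μ θ * Real.cos θ,
          perturbedFermiRadius (fun k : Fin 2 → ℝ => frameShift K (WithLp.toLp 2 k)) μ θ * Real.sin θ)) ≤ r → k ∈ S c)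
    (hcover : ∀ θ ∈ Ioo (-π) π, ∃ c, θ ∈ Icc (αc c) (βc c))
    (hcellp : ∀ c, ∀ k ∈ S c, ∀ k' ∈ S c, ‖(∑ σ : Fin 2, F₀ k σ (k + (x - y))) - ∑ σ : Fin 2, F₀ k' σ (k' + (x - y))‖ ≤ Lc c * klTorusNorm L (k - k'))
    (hcellm : ∀ c, ∀ k ∈ S c, ∀ k' ∈ S c, ‖(∑ σ : Fin 2, F₀ (k + -(x - y)) σ k) - ∑ σ : Fin 2, F₀ (k' + -(x - y)) σ k'‖ ≤ Lc c * klTorusNorm L (k - k'))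
    (hflat : ∀ (i : MatsubaraIdx M) (σ : Fin 2) (k k' : TorusSite 2 L), matsubaraFreq β M i ^ 2 ≤ (4 * klScale klE0 (n + 1)) ^ 2 →
      ‖F (i, k) σ (i, k') - F₀ k σ k'‖ ≤ ε) :
    ‖∑ p : FreqMomentum L M, ∑ σ : Fin 2, ∑ p' : FreqMomentum L M,
        if matsubaraInt M p'.1 + matsubaraInt M (omega0 M) = matsubaraInt M p.1 + matsubaraInt M (omega0 M) ∧ p'.2 = p.2 + x - y then
          ((((((Φ j t p) : ℝ) : ℂ) * (((β * (L : ℝ) ^ 2 : ℝ) : ℂ) * propCT L M β μ K p)) * ((((Wd t p') : ℝ) : ℂ) * (((β * (L : ℝ) ^ 2 : ℝ) : ℂ) * propCT L M β μ K p'))) +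
              (((((Wd t p) : ℝ) : ℂ) * (((β * (L : ℝ) ^ 2 : ℝ) : ℂ) * propCT L M β μ K p)) * ((((Φ j t p') : ℝ) : ℂ) * (((β * (L : ℝ) ^ 2 : ℝ) : ℂ) * propCT L M β μ K p')))) *
            F p σ p'
        else 0‖ ≤
      (β * (L : ℝ) ^ 2) ^ 2 *
          (β * (L : ℝ) ^ 2 * klmsRowBoundTCC B.Dtmin A (4 + 8 / 3 * R.Gfr 1 * U ^ 2) A₀ Kg (∑ c, Lc c * (βc c - αc c))
              (∑ c, (2 * Lc c + 4 * Kg) * (Real.pi / L) * (βc c - αc c)) β n j ((4 + 8 / 3 * R.Gfr 1 * U ^ 2) * klTorusNorm L (x - y)) L +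
            β * (L : ℝ) ^ 2 * klmsRowBoundTCC B.Dtmin A (4 + 8 / 3 * R.Gfr 1 * U ^ 2) A₀ Kg (∑ c, Lc c * (βc c - αc c))
              (∑ c, (2 * Lc c + 4 * Kg) * (Real.pi / L) * (βc c - αc c)) β n j ((4 + 8 / 3 * R.Gfr 1 * U ^ 2) * klTorusNorm L (x - y)) L) +
        ε * (512 / 3 * (β * (L : ℝ) ^ 2) ^ 2 / (klScale klE0 n + t * (klScale klE0 (n + 1) - klScale klE0 n)) ^ 2 *
          ∑ p : FreqMomentum L M, |Φ j t p| * ‖propCT L M β μ K p‖) := by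
  have hβ0 : 0 < β := lt_of_lt_of_le (by norm_num [klBetaMin]) hβ
  have hwd : ∀ p : FreqMomentum L M, (((Φ j t p : ℝ)) : ℂ) * ((((β * (L : ℝ) ^ 2 : ℝ)) : ℂ) * propCT L M β μ K p) =
      (((β * (L : ℝ) ^ 2 : ℝ)) : ℂ) * klfb_prop (klPhiC (klScale klE0 j) (klScale klE0 n + t * (klScale klE0 (n + 1) - klScale klE0 n)))
        (matsubaraFreq β M p.1) (nambuXiCT L μ K p.2) := fun p => by
    rw [hΦ]; exact klfw_memberLine_eq μ K hβ0.ne' n j _ p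
  have h0 := klms_weighted_direct_norm_le β μ K hβ0 n ht (Φ j t) (klPhiC (klScale klE0 j) (klScale klE0 n + t * (klScale klE0 (n + 1) - klScale klE0 n)))
    hwd Wd hWd F F₀ x y hε hflat
  obtain ⟨hlo', hhi'⟩ := scaleAt_mem n ht
  have hΛ1 := klth_klScale_pos (n + 1)
  have hq0 : |(0 : ℝ)| ≤ klScale klE0 (n + 1) / 8 := by rw [abs_zero]; positivity
  refine h0.trans (add_le_add (mul_le_mul_of_nonneg_left (add_le_add ?_ ?_) (by positivity)) le_rfl)
  · have h := klms_pinned_bubble_norm_le_genTCC β μ K B hR hK hAb hA hA20 hμ n ht hj hlo' hhi' hlo hhi hβ hn hM (x - y) hq hq0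
      (Y := fun k : TorusSite 2 L => ∑ σ : Fin 2, F₀ k σ (k + (x - y))) hA0 hKg hY0p hY1p hαβ hLc hr hserve hcellp hcover
    simp only [add_zero, abs_zero, zero_add] at h
    exact h
  · have hq' : (4 + 8 / 3 * R.Gfr 1 * U ^ 2) * klTorusNorm L (-(x - y)) ≤ klScale klE0 (n + 1) / 8 := by rwa [klTorusNorm_neg]
    have h := klms_pinned_bubble_norm_le_genTCC β μ K B hR hK hAb hA hA20 hμ n ht hj hlo' hhi' hlo hhi hβ hn hM (-(x - y)) hq' hq0
      (Y := fun k : TorusSite 2 L => ∑ σ : Fin 2, F₀ (k + -(x - y)) σ k) hA0 hKg hY0m hY1m hαβ hLc hr hserve hcellm hcover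
    simp only [add_zero, abs_zero, zero_add] at h
    rw [klTorusNorm_neg] at h
    exact h

/-- **MEMBER CROSSED SIGNED ROW, GENERIC KERNEL** (`n+1 ≤ j`, `q̃ = Q_m − x − y` with `G|p_q̃|_𝕋 ≤ Λₙ₊₁/8`, `16π/β ≤ Λₙ₊₁`): resolved kernel `F p p′` with pin `F₀`
(`A₀` / `K_g` / angular cells on `k ↦ F₀ k (k + q̃)` and `k ↦ F₀ (k − q̃) k`, crossed flatness `ε` on `ω² ≤ (5Λₙ₊₁)²`) ⟹
`‖S_{Φ,x}[F]‖ ≤ (βL²)²(βL²·Row_j(|−2π/β| + G|p_q̃|) + βL²·Row_j(|2π/β| + G|p_q̃|)) + ε·(256/3)(βL²)²/Λ(t)²·Σ|Φ_j(t)|‖ĝ‖`. -/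
theorem klms_member_crossed_signed_le_genTCC (hR : ∀ j, 0 ≤ R.Gfr j) (hK : FrameOK R U N μ K)
    (hAb : ∀ p : Momentum, ∀ j ≤ 2, ‖iteratedFDeriv ℝ j (frameShift K) p‖ ≤ A) (hA : 4 * A < B.Dtmin) (hA20 : 4 * A ≤ 1 / 20) (hμ : μ ≤ -0.15)
    (n : ℕ) {t : ℝ} (ht : t ∈ Icc (0 : ℝ) 1) (hβ : klBetaMin ≤ β) (hn : n + 1 ≤ nScales β + 1) (hβn : 16 * π / β ≤ klScale klE0 (n + 1))
    (hM : β * (4 * klScale klE0 (n + 1)) / (2 * Real.pi) + 1 ≤ M)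
    (Φ : ℕ → ℝ → FreqMomentum L M → ℝ) (hΦ : Φ = fun j t k => (softSymbolCompl L M β μ K (n + 1) j) k + (hubbardCutoffWeightCT L M β μ K (klScale klE0 (n + 1)) k -
            hubbardCutoffWeightCT L M β μ K (klScale klE0 n + t * (klScale klE0 (n + 1) - klScale klE0 n)) k))
    (Wd : ℝ → FreqMomentum L M → ℝ) (hWd : Wd = fun t k => deriv (fun Λ' : ℝ => hubbardCutoffWeightCT L M β μ K Λ' k) (klScale klE0 n + t * (klScale klE0 (n + 1) - klScale klE0 n)))
    {j : ℕ} (hj : n + 1 ≤ j) (Qm x y : TorusSite 2 L)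
    (hlo : a' < μ - 4 * klScale klE0 (n + 1) - 4 * A) (hhi : μ + 4 * klScale klE0 (n + 1) + 4 * A < b')
    (hq : (4 + 8 / 3 * R.Gfr 1 * U ^ 2) * klTorusNorm L (Qm - x - y) ≤ klScale klE0 (n + 1) / 8)
    (F : FreqMomentum L M → FreqMomentum L M → ℂ) (F₀ : TorusSite 2 L → TorusSite 2 L → ℂ)
    {A₀ Kg ε : ℝ} (hA0 : 0 ≤ A₀) (hKg : 0 ≤ Kg) (hε : 0 ≤ ε)
    (hY0B : ∀ k : TorusSite 2 L, ‖F₀ k (k + (Qm - x - y))‖ ≤ A₀)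
    (hY1B : ∀ k k' : TorusSite 2 L, ‖F₀ k (k + (Qm - x - y)) - F₀ k' (k' + (Qm - x - y))‖ ≤ Kg * klTorusNorm L (k - k'))
    (hY0A : ∀ k : TorusSite 2 L, ‖F₀ (k + -(Qm - x - y)) k‖ ≤ A₀)
    (hY1A : ∀ k k' : TorusSite 2 L, ‖F₀ (k + -(Qm - x - y)) k - F₀ (k' + -(Qm - x - y)) k'‖ ≤ Kg * klTorusNorm L (k - k'))
    {ι : Type*} [Fintype ι] {S : ι → Finset (TorusSite 2 L)} {αc βc Lc : ι → ℝ} (hαβ : ∀ c, αc c ≤ βc c) (hLc : ∀ c, 0 ≤ Lc c)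
    {r : ℝ} (hr : 4 * klScale klE0 (n + 1) / (B.Dtmin - 4 * A) + Real.pi / L ≤ r)
    (hserve : ∀ c, ∀ θ ∈ Icc (αc c) (βc c), ∀ k : TorusSite 2 L,
      torusSupNorm (klpeP L k -
        (perturbedFermiRadius (fun k : Fin 2 → ℝ => frameShift K (WithLp.toLp 2 k)) μ θ * Real.cos θ,
          perturbedFermiRadius (fun k : Fin 2 → ℝ => frameShift K (WithLp.toLp 2 k)) μ θ * Real.sin θ)) ≤ r → k ∈ S c)
    (hcover : ∀ θ ∈ Ioo (-π) π, ∃ c, θ ∈ Icc (αc c) (βc c))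
    (hcellB : ∀ c, ∀ k ∈ S c, ∀ k' ∈ S c, ‖F₀ k (k + (Qm - x - y)) - F₀ k' (k' + (Qm - x - y))‖ ≤ Lc c * klTorusNorm L (k - k'))
    (hcellA : ∀ c, ∀ k ∈ S c, ∀ k' ∈ S c, ‖F₀ (k + -(Qm - x - y)) k - F₀ (k' + -(Qm - x - y)) k'‖ ≤ Lc c * klTorusNorm L (k - k'))
    (hflat : ∀ (i i' : MatsubaraIdx M) (k k' : TorusSite 2 L), matsubaraInt M i' + 1 = matsubaraInt M i →
      matsubaraFreq β M i ^ 2 ≤ (5 * klScale klE0 (n + 1)) ^ 2 → ‖F (i, k) (i', k') - F₀ k k'‖ ≤ ε) :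
    ‖∑ p : FreqMomentum L M, ∑ p' : FreqMomentum L M,
        if matsubaraInt M p'.1 + matsubaraInt M (omega0 M) + matsubaraInt M (omega0 M) + 1 = matsubaraInt M p.1 ∧ p'.2 = p.2 + Qm - x - y then
          ((((((Φ j t p) : ℝ) : ℂ) * (((β * (L : ℝ) ^ 2 : ℝ) : ℂ) * propCT L M β μ K p)) * ((((Wd t p') : ℝ) : ℂ) * (((β * (L : ℝ) ^ 2 : ℝ) : ℂ) * propCT L M β μ K p'))) +
              (((((Wd t p) : ℝ) : ℂ) * (((β * (L : ℝ) ^ 2 : ℝ) : ℂ) * propCT L M β μ K p)) * ((((Φ j t p') : ℝ) : ℂ) * (((β * (L : ℝ) ^ 2 : ℝ) : ℂ) * propCT L M β μ K p')))) *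
            F p p'
        else 0‖ ≤
      (β * (L : ℝ) ^ 2) ^ 2 *
          (β * (L : ℝ) ^ 2 * klmsRowBoundTCC B.Dtmin A (4 + 8 / 3 * R.Gfr 1 * U ^ 2) A₀ Kg (∑ c, Lc c * (βc c - αc c))
              (∑ c, (2 * Lc c + 4 * Kg) * (Real.pi / L) * (βc c - αc c)) β n j
              (|-(2 * π / β)| + (4 + 8 / 3 * R.Gfr 1 * U ^ 2) * klTorusNorm L (Qm - x - y)) L +
            β * (L : ℝ) ^ 2 * klmsRowBoundTCC B.Dtmin A (4 + 8 / 3 * R.Gfr 1 * U ^ 2) A₀ Kg (∑ c, Lc c * (βc c - αc c))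
              (∑ c, (2 * Lc c + 4 * Kg) * (Real.pi / L) * (βc c - αc c)) β n j
              (|2 * π / β| + (4 + 8 / 3 * R.Gfr 1 * U ^ 2) * klTorusNorm L (Qm - x - y)) L) +
        ε * (256 / 3 * (β * (L : ℝ) ^ 2) ^ 2 / (klScale klE0 n + t * (klScale klE0 (n + 1) - klScale klE0 n)) ^ 2 *
          ∑ p : FreqMomentum L M, |Φ j t p| * ‖propCT L M β μ K p‖) := by
  have hβ0 : 0 < β := lt_of_lt_of_le (by norm_num [klBetaMin]) hβ
  have hwd : ∀ p : FreqMomentum L M, (((Φ j t p : ℝ)) : ℂ) * ((((β * (L : ℝ) ^ 2 : ℝ)) : ℂ) * propCT L M β μ K p) =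
      (((β * (L : ℝ) ^ 2 : ℝ)) : ℂ) * klfb_prop (klPhiC (klScale klE0 j) (klScale klE0 n + t * (klScale klE0 (n + 1) - klScale klE0 n)))
        (matsubaraFreq β M p.1) (nambuXiCT L μ K p.2) := fun p => by
    rw [hΦ]; exact klfw_memberLine_eq μ K hβ0.ne' n j _ p
  have h0 := klms_weighted_crossed_norm_le β μ K hβ0 n ht hβn hM (Φ j t) (klPhiC (klScale klE0 j) (klScale klE0 n + t * (klScale klE0 (n + 1) - klScale klE0 n)))
    hwd Wd hWd F F₀ Qm x y hε hflat
  have h2π : |2 * π / β| ≤ klScale klE0 (n + 1) / 8 := by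
    rw [abs_of_pos (by positivity)]
    have : 2 * π / β = (16 * π / β) / 8 := by ring
    rw [this]; exact div_le_div_of_nonneg_right hβn (by norm_num)
  have h2π' : |-(2 * π / β)| ≤ klScale klE0 (n + 1) / 8 := by rw [abs_neg]; exact h2π
  obtain ⟨hlo', hhi'⟩ := scaleAt_mem n ht
  refine h0.trans (add_le_add (mul_le_mul_of_nonneg_left (add_le_add ?_ ?_) (by positivity)) le_rfl)
  · exact klms_pinned_bubble_norm_le_genTCC β μ K B hR hK hAb hA hA20 hμ n ht hj hlo' hhi' hlo hhi hβ hn hM (Qm - x - y) hq h2π'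
      (Y := fun k : TorusSite 2 L => F₀ k (k + (Qm - x - y))) hA0 hKg hY0B hY1B hαβ hLc hr hserve hcellB hcover
  · have hq' : (4 + 8 / 3 * R.Gfr 1 * U ^ 2) * klTorusNorm L (-(Qm - x - y)) ≤ klScale klE0 (n + 1) / 8 := by rwa [klTorusNorm_neg]
    have h := klms_pinned_bubble_norm_le_genTCC β μ K B hR hK hAb hA hA20 hμ n ht hj hlo' hhi' hlo hhi hβ hn hM (-(Qm - x - y)) hq' h2π
      (Y := fun k : TorusSite 2 L => F₀ (k + -(Qm - x - y)) k) hA0 hKg hY0A hY1A hαβ hLc hr hserve hcellA hcover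
    rw [klTorusNorm_neg] at h
    exact h

/-! ## §2 The member rows under the cell split -/

/-- **MEMBER DIRECT ROW, CELL SPLIT `V_j⊗V_j = c + F₁ + Σ_w F₂ʷ`** (`n+1 ≤ j`, window `G|p_{x−y}| ≤ Λₙ₊₁/8`): `c` constant (data `(2‖c‖,0,0)`, proved), `F₁` with
data `(A₁, K_g, angular cells, ε₁)` against its pin `F₁₀`, a finite window family `F₂ʷ` ⟹ `‖S_Φ‖ ≤ c-row + (F₁-row(cells) + ε₁·flat) +
Σ_w A₂ʷ·(512/3)(βL²)²/Λ(t)²·(2·(15381(ρ_w/π + 1/L)·Λₙ·βL²))` (the running member symbol is soft at scale `n`). -/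
theorem member_direct_signed_le_splitCells (hR : ∀ j, 0 ≤ R.Gfr j) (hK : FrameOK R U N μ K)
    (hAb : ∀ p : Momentum, ∀ j ≤ 2, ‖iteratedFDeriv ℝ j (frameShift K) p‖ ≤ A) (hA : 4 * A < B.Dtmin) (hA20 : 4 * A ≤ 1 / 20) (hμ : μ ≤ -0.15)
    (n : ℕ) {t : ℝ} (ht : t ∈ Icc (0 : ℝ) 1) (hβ : klBetaMin ≤ β) (hβL : β ≤ L) (hn : n + 1 ≤ nScales β + 1)
    (hM : β * (4 * klScale klE0 (n + 1)) / (2 * Real.pi) + 1 ≤ M)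
    (Φ : ℕ → ℝ → FreqMomentum L M → ℝ) (hΦ : Φ = fun j t k => (softSymbolCompl L M β μ K (n + 1) j) k + (hubbardCutoffWeightCT L M β μ K (klScale klE0 (n + 1)) k -
            hubbardCutoffWeightCT L M β μ K (klScale klE0 n + t * (klScale klE0 (n + 1) - klScale klE0 n)) k))
    (Wd : ℝ → FreqMomentum L M → ℝ) (hWd : Wd = fun t k => deriv (fun Λ' : ℝ => hubbardCutoffWeightCT L M β μ K Λ' k) (klScale klE0 n + t * (klScale klE0 (n + 1) - klScale klE0 n)))
    (V : ℕ → ℝ → (Fin 4 → HubbardFieldIdx L M) → ℂ) {j : ℕ} (hj : n + 1 ≤ j) (Qm x y : TorusSite 2 L)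
    (hlo : a' < μ - 4 * klScale klE0 (n + 1) - 4 * A) (hhi : μ + 4 * klScale klE0 (n + 1) + 4 * A < b')
    (hq : (4 + 8 / 3 * R.Gfr 1 * U ^ 2) * klTorusNorm L (x - y) ≤ klScale klE0 (n + 1) / 8)
    (c : ℂ) (F₁ : FreqMomentum L M → Fin 2 → FreqMomentum L M → ℂ) {ι' : Type*} [Fintype ι'] (F₂ : ι' → FreqMomentum L M → Fin 2 → FreqMomentum L M → ℂ)
    (F₁₀ : TorusSite 2 L → Fin 2 → TorusSite 2 L → ℂ)
    (hsplit : ∀ (p : FreqMomentum L M) (σ : Fin 2) (p' : FreqMomentum L M),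
      V j t ![((p, σ), 1), ((p', σ), 0), (((omega0 M, y), 0), 0), (((omega0 M, x), 0), 1)] *
          V j t ![((p, σ), 0), ((p', σ), 1), ((((omega0 M).rev, Qm - y), 1), 0), ((((omega0 M).rev, Qm - x), 1), 1)] = c + F₁ p σ p' + ∑ w, F₂ w p σ p')
    {A₁ Kg ε₁ : ℝ} (hA1 : 0 ≤ A₁) (hKg : 0 ≤ Kg) (hε1 : 0 ≤ ε₁)
    (hY0p₁ : ∀ k : TorusSite 2 L, ‖∑ σ : Fin 2, F₁₀ k σ (k + (x - y))‖ ≤ A₁)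
    (hY1p₁ : ∀ k k' : TorusSite 2 L, ‖(∑ σ : Fin 2, F₁₀ k σ (k + (x - y))) - ∑ σ : Fin 2, F₁₀ k' σ (k' + (x - y))‖ ≤ Kg * klTorusNorm L (k - k'))
    (hY0m₁ : ∀ k : TorusSite 2 L, ‖∑ σ : Fin 2, F₁₀ (k + -(x - y)) σ k‖ ≤ A₁)
    (hY1m₁ : ∀ k k' : TorusSite 2 L, ‖(∑ σ : Fin 2, F₁₀ (k + -(x - y)) σ k) - ∑ σ : Fin 2, F₁₀ (k' + -(x - y)) σ k'‖ ≤ Kg * klTorusNorm L (k - k'))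
    {ι : Type*} [Fintype ι] {S : ι → Finset (TorusSite 2 L)} {αc βc Lc : ι → ℝ} (hαβ : ∀ c, αc c ≤ βc c) (hLc : ∀ c, 0 ≤ Lc c)
    {r : ℝ} (hr : 4 * klScale klE0 (n + 1) / (B.Dtmin - 4 * A) + Real.pi / L ≤ r)
    (hserve : ∀ c, ∀ θ ∈ Icc (αc c) (βc c), ∀ k : TorusSite 2 L,
      torusSupNorm (klpeP L k -
        (perturbedFermiRadius (fun k : Fin 2 → ℝ => frameShift K (WithLp.toLp 2 k)) μ θ * Real.cos θ,
          perturbedFermiRadius (fun k : Fin 2 → ℝ => frameShift K (WithLp.toLp 2 k)) μ θ * Real.sin θ)) ≤ r → k ∈ S c)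
    (hcover : ∀ θ ∈ Ioo (-π) π, ∃ c, θ ∈ Icc (αc c) (βc c))
    (hcellp : ∀ c, ∀ k ∈ S c, ∀ k' ∈ S c, ‖(∑ σ : Fin 2, F₁₀ k σ (k + (x - y))) - ∑ σ : Fin 2, F₁₀ k' σ (k' + (x - y))‖ ≤ Lc c * klTorusNorm L (k - k'))
    (hcellm : ∀ c, ∀ k ∈ S c, ∀ k' ∈ S c, ‖(∑ σ : Fin 2, F₁₀ (k + -(x - y)) σ k) - ∑ σ : Fin 2, F₁₀ (k' + -(x - y)) σ k'‖ ≤ Lc c * klTorusNorm L (k - k'))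
    (hflat₁ : ∀ (i : MatsubaraIdx M) (σ : Fin 2) (k k' : TorusSite 2 L), matsubaraFreq β M i ^ 2 ≤ (4 * klScale klE0 (n + 1)) ^ 2 →
      ‖F₁ (i, k) σ (i, k') - F₁₀ k σ k'‖ ≤ ε₁)
    (cen : ι' → TorusSite 2 L) {ρ A₂ : ι' → ℝ} (hρ : ∀ w, 0 ≤ ρ w) (hA2 : ∀ w, 0 ≤ A₂ w)
    (hF₂ : ∀ w (p : FreqMomentum L M) (σ : Fin 2) (p' : FreqMomentum L M), ‖F₂ w p σ p'‖ ≤ A₂ w)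
    (hsupp₂ : ∀ w (p : FreqMomentum L M) (σ : Fin 2) (p' : FreqMomentum L M), ρ w < klTorusNorm L (p.2 - cen w) → F₂ w p σ p' = 0) :
    ‖∑ p : FreqMomentum L M, ∑ σ : Fin 2, ∑ p' : FreqMomentum L M,
        if matsubaraInt M p'.1 + matsubaraInt M (omega0 M) = matsubaraInt M p.1 + matsubaraInt M (omega0 M) ∧ p'.2 = p.2 + x - y then
          ((((((Φ j t p) : ℝ) : ℂ) * (((β * (L : ℝ) ^ 2 : ℝ) : ℂ) * propCT L M β μ K p)) * ((((Wd t p') : ℝ) : ℂ) * (((β * (L : ℝ) ^ 2 : ℝ) : ℂ) * propCT L M β μ K p'))) +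
              (((((Wd t p) : ℝ) : ℂ) * (((β * (L : ℝ) ^ 2 : ℝ) : ℂ) * propCT L M β μ K p)) * ((((Φ j t p') : ℝ) : ℂ) * (((β * (L : ℝ) ^ 2 : ℝ) : ℂ) * propCT L M β μ K p')))) *
            (V j t ![((p, σ), 1), ((p', σ), 0), (((omega0 M, y), 0), 0), (((omega0 M, x), 0), 1)] *
              V j t ![((p, σ), 0), ((p', σ), 1), ((((omega0 M).rev, Qm - y), 1), 0), ((((omega0 M).rev, Qm - x), 1), 1)])
        else 0‖ ≤
      (β * (L : ℝ) ^ 2) ^ 2 *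
          (β * (L : ℝ) ^ 2 * klmsRowBound B.Dtmin A (4 + 8 / 3 * R.Gfr 1 * U ^ 2) (2 * ‖c‖) 0 β n j ((4 + 8 / 3 * R.Gfr 1 * U ^ 2) * klTorusNorm L (x - y)) L +
            β * (L : ℝ) ^ 2 * klmsRowBound B.Dtmin A (4 + 8 / 3 * R.Gfr 1 * U ^ 2) (2 * ‖c‖) 0 β n j ((4 + 8 / 3 * R.Gfr 1 * U ^ 2) * klTorusNorm L (x - y)) L) +
      ((β * (L : ℝ) ^ 2) ^ 2 *
          (β * (L : ℝ) ^ 2 * klmsRowBoundTCC B.Dtmin A (4 + 8 / 3 * R.Gfr 1 * U ^ 2) A₁ Kg (∑ c, Lc c * (βc c - αc c))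
              (∑ c, (2 * Lc c + 4 * Kg) * (Real.pi / L) * (βc c - αc c)) β n j ((4 + 8 / 3 * R.Gfr 1 * U ^ 2) * klTorusNorm L (x - y)) L +
            β * (L : ℝ) ^ 2 * klmsRowBoundTCC B.Dtmin A (4 + 8 / 3 * R.Gfr 1 * U ^ 2) A₁ Kg (∑ c, Lc c * (βc c - αc c))
              (∑ c, (2 * Lc c + 4 * Kg) * (Real.pi / L) * (βc c - αc c)) β n j ((4 + 8 / 3 * R.Gfr 1 * U ^ 2) * klTorusNorm L (x - y)) L) +
        ε₁ * (512 / 3 * (β * (L : ℝ) ^ 2) ^ 2 / (klScale klE0 n + t * (klScale klE0 (n + 1) - klScale klE0 n)) ^ 2 *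
          ∑ p : FreqMomentum L M, |Φ j t p| * ‖propCT L M β μ K p‖)) +
      ∑ w, A₂ w * (512 / 3 * (β * (L : ℝ) ^ 2) ^ 2 / (klScale klE0 n + t * (klScale klE0 (n + 1) - klScale klE0 n)) ^ 2 *
        (2 * (15381 * (ρ w / π + ((L : ℝ))⁻¹) * klScale klE0 n * β * (L : ℝ) ^ 2))) := by
  -- (1) split the kernel twice
  set P : FreqMomentum L M → FreqMomentum L M → Prop := fun p p' =>
    matsubaraInt M p'.1 + matsubaraInt M (omega0 M) = matsubaraInt M p.1 + matsubaraInt M (omega0 M) ∧ p'.2 = p.2 + x - y with hP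
  set ln : FreqMomentum L M → FreqMomentum L M → ℂ := fun p p' =>
    (((((Φ j t p) : ℝ) : ℂ) * (((β * (L : ℝ) ^ 2 : ℝ) : ℂ) * propCT L M β μ K p)) * ((((Wd t p') : ℝ) : ℂ) * (((β * (L : ℝ) ^ 2 : ℝ) : ℂ) * propCT L M β μ K p'))) +
      (((((Wd t p) : ℝ) : ℂ) * (((β * (L : ℝ) ^ 2 : ℝ) : ℂ) * propCT L M β μ K p)) * ((((Φ j t p') : ℝ) : ℂ) * (((β * (L : ℝ) ^ 2 : ℝ) : ℂ) * propCT L M β μ K p'))) with hln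
  have e := (((pinned_direct_sum_kernel_congr P ln hsplit).trans (pinned_direct_sum_kernel_add P ln (fun p σ p' => c + F₁ p σ p') (fun p σ p' => ∑ w, F₂ w p σ p'))).trans
    (congrArg (· + _) (pinned_direct_sum_kernel_add P ln (fun _ _ _ => c) F₁))).trans (congrArg (_ + ·) (pinned_direct_sum_kernel_sum P ln F₂))
  simp only [hP, hln] at e
  rw [e]
  -- (2) the three rows
  have h2c : ∀ k : TorusSite 2 L, ‖∑ _σ : Fin 2, (fun (_ : TorusSite 2 L) (_ : Fin 2) (_ : TorusSite 2 L) => c) k 0 k‖ ≤ 2 * ‖c‖ := fun k => by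
    simp only [Finset.sum_const, Finset.card_univ, Fintype.card_fin, nsmul_eq_mul, Nat.cast_ofNat, norm_mul, Complex.norm_ofNat, le_refl]
  have hc := klms_member_direct_signed_le_gen β μ K B hR hK hAb hA hA20 hμ n ht hβ hn hM Φ hΦ Wd hWd hj x y hlo hhi hq
    (fun _ _ _ => c) (fun _ _ _ => c) (A₀ := 2 * ‖c‖) (LA := 0) (ε := 0) (by positivity) le_rfl le_rfl
    (fun k => h2c k) (fun k k' => by simp) (fun k => h2c k) (fun k k' => by simp) (fun i σ k k' _ => by simp)
  rw [zero_mul, add_zero] at hc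
  have h1 := klms_member_direct_signed_le_genTCC β μ K B hR hK hAb hA hA20 hμ n ht hβ hn hM Φ hΦ Wd hWd hj x y hlo hhi hq F₁ F₁₀
    hA1 hKg hε1 hY0p₁ hY1p₁ hY0m₁ hY1m₁ hαβ hLc hr hserve hcover hcellp hcellm hflat₁
  have hw : ∀ k : FreqMomentum L M, 0 ≤ Φ j t k ∧ Φ j t k ≤ 1 - hubbardCutoffWeightCT L M β μ K (klScale klE0 n) k := fun k => by
    rw [hΦ]; exact klmf_runningSymbol_mem L M β μ K n (isSoftSymbol_compl β μ K hj).1 ht k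
  have h2 := fun w => klms_weighted_direct_norm_le_of_support_soft β μ K hK hβ hβL n n ht hw Wd hWd (F₂ w) x y (cen w) (hρ w) (hA2 w) (hF₂ w) (hsupp₂ w)
  have h2s := (norm_sum_le _ _).trans (Finset.sum_le_sum fun w (_ : w ∈ Finset.univ) => h2 w)
  exact (norm_add_le _ _).trans (add_le_add ((norm_add_le _ _).trans (add_le_add hc h1)) h2s)

/-- **MEMBER CROSSED ROW, CELL SPLIT `V_j⊗V_j = c + F₁ + Σ_w F₂ʷ`** (`n+1 ≤ j`, window `G|p_{Q_m−x−y}| ≤ Λₙ₊₁/8`, `16π/β ≤ Λₙ₊₁`): `c` constant (data `(‖c‖,0,0)`),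
`F₁` with data `(A₁, K_g, angular cells, ε₁)`, a finite window family `F₂ʷ` ⟹ `‖S_{Φ,x}‖ ≤ c-row + (F₁-row(cells) + ε₁·flat) +
Σ_w A₂ʷ·(256/3)(βL²)²/Λ(t)²·(2·(15381(ρ_w/π + 1/L)·Λₙ·βL²))`. -/
theorem member_crossed_signed_le_splitCells (hR : ∀ j, 0 ≤ R.Gfr j) (hK : FrameOK R U N μ K)
    (hAb : ∀ p : Momentum, ∀ j ≤ 2, ‖iteratedFDeriv ℝ j (frameShift K) p‖ ≤ A) (hA : 4 * A < B.Dtmin) (hA20 : 4 * A ≤ 1 / 20) (hμ : μ ≤ -0.15)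
    (n : ℕ) {t : ℝ} (ht : t ∈ Icc (0 : ℝ) 1) (hβ : klBetaMin ≤ β) (hβL : β ≤ L) (hn : n + 1 ≤ nScales β + 1) (hβn : 16 * π / β ≤ klScale klE0 (n + 1))
    (hM : β * (4 * klScale klE0 (n + 1)) / (2 * Real.pi) + 1 ≤ M)
    (Φ : ℕ → ℝ → FreqMomentum L M → ℝ) (hΦ : Φ = fun j t k => (softSymbolCompl L M β μ K (n + 1) j) k + (hubbardCutoffWeightCT L M β μ K (klScale klE0 (n + 1)) k -
            hubbardCutoffWeightCT L M β μ K (klScale klE0 n + t * (klScale klE0 (n + 1) - klScale klE0 n)) k))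
    (Wd : ℝ → FreqMomentum L M → ℝ) (hWd : Wd = fun t k => deriv (fun Λ' : ℝ => hubbardCutoffWeightCT L M β μ K Λ' k) (klScale klE0 n + t * (klScale klE0 (n + 1) - klScale klE0 n)))
    (V : ℕ → ℝ → (Fin 4 → HubbardFieldIdx L M) → ℂ) {j : ℕ} (hj : n + 1 ≤ j) (Qm x y : TorusSite 2 L)
    (hlo : a' < μ - 4 * klScale klE0 (n + 1) - 4 * A) (hhi : μ + 4 * klScale klE0 (n + 1) + 4 * A < b')
    (hq : (4 + 8 / 3 * R.Gfr 1 * U ^ 2) * klTorusNorm L (Qm - x - y) ≤ klScale klE0 (n + 1) / 8)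
    (c : ℂ) (F₁ : FreqMomentum L M → FreqMomentum L M → ℂ) {ι' : Type*} [Fintype ι'] (F₂ : ι' → FreqMomentum L M → FreqMomentum L M → ℂ)
    (F₁₀ : TorusSite 2 L → TorusSite 2 L → ℂ)
    (hsplit : ∀ (p p' : FreqMomentum L M),
      V j t ![((p, 0), 1), ((p', 1), 0), (((omega0 M, y), 0), 0), ((((omega0 M).rev, Qm - x), 1), 1)] *
          V j t ![((p, 0), 0), ((p', 1), 1), ((((omega0 M).rev, Qm - y), 1), 0), (((omega0 M, x), 0), 1)] = c + F₁ p p' + ∑ w, F₂ w p p')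
    {A₁ Kg ε₁ : ℝ} (hA1 : 0 ≤ A₁) (hKg : 0 ≤ Kg) (hε1 : 0 ≤ ε₁)
    (hY0B₁ : ∀ k : TorusSite 2 L, ‖F₁₀ k (k + (Qm - x - y))‖ ≤ A₁)
    (hY1B₁ : ∀ k k' : TorusSite 2 L, ‖F₁₀ k (k + (Qm - x - y)) - F₁₀ k' (k' + (Qm - x - y))‖ ≤ Kg * klTorusNorm L (k - k'))
    (hY0A₁ : ∀ k : TorusSite 2 L, ‖F₁₀ (k + -(Qm - x - y)) k‖ ≤ A₁)
    (hY1A₁ : ∀ k k' : TorusSite 2 L, ‖F₁₀ (k + -(Qm - x - y)) k - F₁₀ (k' + -(Qm - x - y)) k'‖ ≤ Kg * klTorusNorm L (k - k'))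
    {ι : Type*} [Fintype ι] {S : ι → Finset (TorusSite 2 L)} {αc βc Lc : ι → ℝ} (hαβ : ∀ c, αc c ≤ βc c) (hLc : ∀ c, 0 ≤ Lc c)
    {r : ℝ} (hr : 4 * klScale klE0 (n + 1) / (B.Dtmin - 4 * A) + Real.pi / L ≤ r)
    (hserve : ∀ c, ∀ θ ∈ Icc (αc c) (βc c), ∀ k : TorusSite 2 L,
      torusSupNorm (klpeP L k -
        (perturbedFermiRadius (fun k : Fin 2 → ℝ => frameShift K (WithLp.toLp 2 k)) μ θ * Real.cos θ,
          perturbedFermiRadius (fun k : Fin 2 → ℝ => frameShift K (WithLp.toLp 2 k)) μ θ * Real.sin θ)) ≤ r → k ∈ S c)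
    (hcover : ∀ θ ∈ Ioo (-π) π, ∃ c, θ ∈ Icc (αc c) (βc c))
    (hcellB : ∀ c, ∀ k ∈ S c, ∀ k' ∈ S c, ‖F₁₀ k (k + (Qm - x - y)) - F₁₀ k' (k' + (Qm - x - y))‖ ≤ Lc c * klTorusNorm L (k - k'))
    (hcellA : ∀ c, ∀ k ∈ S c, ∀ k' ∈ S c, ‖F₁₀ (k + -(Qm - x - y)) k - F₁₀ (k' + -(Qm - x - y)) k'‖ ≤ Lc c * klTorusNorm L (k - k'))
    (hflat₁ : ∀ (i i' : MatsubaraIdx M) (k k' : TorusSite 2 L), matsubaraInt M i' + 1 = matsubaraInt M i →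
      matsubaraFreq β M i ^ 2 ≤ (5 * klScale klE0 (n + 1)) ^ 2 → ‖F₁ (i, k) (i', k') - F₁₀ k k'‖ ≤ ε₁)
    (cen : ι' → TorusSite 2 L) {ρ A₂ : ι' → ℝ} (hρ : ∀ w, 0 ≤ ρ w) (hA2 : ∀ w, 0 ≤ A₂ w)
    (hF₂ : ∀ w (p p' : FreqMomentum L M), ‖F₂ w p p'‖ ≤ A₂ w)
    (hsupp₂ : ∀ w (p p' : FreqMomentum L M), ρ w < klTorusNorm L (p.2 - cen w) → F₂ w p p' = 0) :
    ‖∑ p : FreqMomentum L M, ∑ p' : FreqMomentum L M,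
        if matsubaraInt M p'.1 + matsubaraInt M (omega0 M) + matsubaraInt M (omega0 M) + 1 = matsubaraInt M p.1 ∧ p'.2 = p.2 + Qm - x - y then
          ((((((Φ j t p) : ℝ) : ℂ) * (((β * (L : ℝ) ^ 2 : ℝ) : ℂ) * propCT L M β μ K p)) * ((((Wd t p') : ℝ) : ℂ) * (((β * (L : ℝ) ^ 2 : ℝ) : ℂ) * propCT L M β μ K p'))) +
              (((((Wd t p) : ℝ) : ℂ) * (((β * (L : ℝ) ^ 2 : ℝ) : ℂ) * propCT L M β μ K p)) * ((((Φ j t p') : ℝ) : ℂ) * (((β * (L : ℝ) ^ 2 : ℝ) : ℂ) * propCT L M β μ K p')))) *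
            (V j t ![((p, 0), 1), ((p', 1), 0), (((omega0 M, y), 0), 0), ((((omega0 M).rev, Qm - x), 1), 1)] *
              V j t ![((p, 0), 0), ((p', 1), 1), ((((omega0 M).rev, Qm - y), 1), 0), (((omega0 M, x), 0), 1)])
        else 0‖ ≤
      (β * (L : ℝ) ^ 2) ^ 2 *
          (β * (L : ℝ) ^ 2 * klmsRowBound B.Dtmin A (4 + 8 / 3 * R.Gfr 1 * U ^ 2) ‖c‖ 0 β n j
              (|-(2 * π / β)| + (4 + 8 / 3 * R.Gfr 1 * U ^ 2) * klTorusNorm L (Qm - x - y)) L +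
            β * (L : ℝ) ^ 2 * klmsRowBound B.Dtmin A (4 + 8 / 3 * R.Gfr 1 * U ^ 2) ‖c‖ 0 β n j
              (|2 * π / β| + (4 + 8 / 3 * R.Gfr 1 * U ^ 2) * klTorusNorm L (Qm - x - y)) L) +
      ((β * (L : ℝ) ^ 2) ^ 2 *
          (β * (L : ℝ) ^ 2 * klmsRowBoundTCC B.Dtmin A (4 + 8 / 3 * R.Gfr 1 * U ^ 2) A₁ Kg (∑ c, Lc c * (βc c - αc c))
              (∑ c, (2 * Lc c + 4 * Kg) * (Real.pi / L) * (βc c - αc c)) β n j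
              (|-(2 * π / β)| + (4 + 8 / 3 * R.Gfr 1 * U ^ 2) * klTorusNorm L (Qm - x - y)) L +
            β * (L : ℝ) ^ 2 * klmsRowBoundTCC B.Dtmin A (4 + 8 / 3 * R.Gfr 1 * U ^ 2) A₁ Kg (∑ c, Lc c * (βc c - αc c))
              (∑ c, (2 * Lc c + 4 * Kg) * (Real.pi / L) * (βc c - αc c)) β n j
              (|2 * π / β| + (4 + 8 / 3 * R.Gfr 1 * U ^ 2) * klTorusNorm L (Qm - x - y)) L) +
        ε₁ * (256 / 3 * (β * (L : ℝ) ^ 2) ^ 2 / (klScale klE0 n + t * (klScale klE0 (n + 1) - klScale klE0 n)) ^ 2 *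
          ∑ p : FreqMomentum L M, |Φ j t p| * ‖propCT L M β μ K p‖)) +
      ∑ w, A₂ w * (256 / 3 * (β * (L : ℝ) ^ 2) ^ 2 / (klScale klE0 n + t * (klScale klE0 (n + 1) - klScale klE0 n)) ^ 2 *
        (2 * (15381 * (ρ w / π + ((L : ℝ))⁻¹) * klScale klE0 n * β * (L : ℝ) ^ 2))) := by
  -- (1) split the kernel twice
  set P : FreqMomentum L M → FreqMomentum L M → Prop := fun p p' =>
    matsubaraInt M p'.1 + matsubaraInt M (omega0 M) + matsubaraInt M (omega0 M) + 1 = matsubaraInt M p.1 ∧ p'.2 = p.2 + Qm - x - y with hP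
  set ln : FreqMomentum L M → FreqMomentum L M → ℂ := fun p p' =>
    (((((Φ j t p) : ℝ) : ℂ) * (((β * (L : ℝ) ^ 2 : ℝ) : ℂ) * propCT L M β μ K p)) * ((((Wd t p') : ℝ) : ℂ) * (((β * (L : ℝ) ^ 2 : ℝ) : ℂ) * propCT L M β μ K p'))) +
      (((((Wd t p) : ℝ) : ℂ) * (((β * (L : ℝ) ^ 2 : ℝ) : ℂ) * propCT L M β μ K p)) * ((((Φ j t p') : ℝ) : ℂ) * (((β * (L : ℝ) ^ 2 : ℝ) : ℂ) * propCT L M β μ K p'))) with hln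
  have e := (((pinned_crossed_sum_kernel_congr P ln hsplit).trans (pinned_crossed_sum_kernel_add P ln (fun p p' => c + F₁ p p') (fun p p' => ∑ w, F₂ w p p'))).trans
    (congrArg (· + _) (pinned_crossed_sum_kernel_add P ln (fun _ _ => c) F₁))).trans (congrArg (_ + ·) (pinned_crossed_sum_kernel_sum P ln F₂))
  simp only [hP, hln] at e
  rw [e]
  -- (2) the three rows
  have hc := klms_member_crossed_signed_le_gen β μ K B hR hK hAb hA hA20 hμ n ht hβ hn hβn hM Φ hΦ Wd hWd hj Qm x y hlo hhi hq
    (fun _ _ => c) (fun _ _ => c) (A₀ := ‖c‖) (LA := 0) (ε := 0) (norm_nonneg c) le_rfl le_rfl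
    (fun k => le_rfl) (fun k k' => by simp) (fun k => le_rfl) (fun k k' => by simp) (fun i i' k k' _ _ => by simp)
  rw [zero_mul, add_zero] at hc
  have h1 := klms_member_crossed_signed_le_genTCC β μ K B hR hK hAb hA hA20 hμ n ht hβ hn hβn hM Φ hΦ Wd hWd hj Qm x y hlo hhi hq F₁ F₁₀
    hA1 hKg hε1 hY0B₁ hY1B₁ hY0A₁ hY1A₁ hαβ hLc hr hserve hcover hcellB hcellA hflat₁
  have hw : ∀ k : FreqMomentum L M, 0 ≤ Φ j t k ∧ Φ j t k ≤ 1 - hubbardCutoffWeightCT L M β μ K (klScale klE0 n) k := fun k => by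
    rw [hΦ]; exact klmf_runningSymbol_mem L M β μ K n (isSoftSymbol_compl β μ K hj).1 ht k
  have h2 := fun w => klms_weighted_crossed_norm_le_of_support_soft β μ K hK hβ hβL n n ht hw Wd hWd (F₂ w) Qm x y (cen w) (hρ w) (hA2 w) (hF₂ w)
    (hsupp₂ w)
  have h2s := (norm_sum_le _ _).trans (Finset.sum_le_sum fun w (_ : w ∈ Finset.univ) => h2 w)
  exact (norm_add_le _ _).trans (add_le_add ((norm_add_le _ _).trans (add_le_add hc h1)) h2s)

end Model

end Summit.HubbardSuperconductivity.HubbardSuperconductivity.Theorems.KLRegimeSplit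

end
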